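import Literature.AlgebraicGeometry.RelativeSpec.EquivariantModuleInvariants
import Literature.AlgebraicGeometry.Modules.PullbackQuasicoherent
import Mathlib.CategoryTheory.Monoidal.Cartesian.Over
import Mathlib.CategoryTheory.Monoidal.Cartesian.Mod
import HarnessLib

/-!
# Equivariant quasi-coherent modules for a GROUP-SCHEME action along an invariant morphism:
# the module of invariants `(π_* E)^G := ker (π_* E ⇉ π_* pr₂_* pr₂^* E)` and `π^* (π_* E)^G ⟶ E`

The group-SCHEME twin of ★ `RelativeSpec/EquivariantModuleInvariants` (constant finite groups).
Mathlib currency `[GrpObj G] [ModObj G X]` in `Over S` (action `σ := (γ[G, X]).left`,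
projection `pr₂ := (snd G X).left : G ×_S X → X`), an invariant morphism `π : X ⟶ Q`
(`γ ≫ π = pr₂ ≫ π`), an `𝒪_X`-module `E` and a `G`-LINEARISATION given by its MORPHISM `Φ : σ^* E ⟶ pr₂^* E` (for a
linearisation in the sense of [MFK94] Ch. 1 §3 Def. 1.6 this is the `.hom` of the isomorphism; neither
invertibility nor the unit ∕ cocycle conditions are needed for anything in this file and they are
therefore not assumed — they enter only the descent theorem of the sequel).

* `pushforwardUnitSnd π E : π_* E ⟶ π_* pr₂_* pr₂^* E` — `π_*` of the unit `η_{pr₂}`; on sections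
  over `V ⊆ Q`: `s ↦ η_{pr₂}(s) = «1 ⊗ s»` (`pushforwardUnitSnd_app`);
* `pushforwardUnitSmul π E hw Φ : π_* E ⟶ π_* pr₂_* pr₂^* E` — `π_*` of `η_σ` followed by `σ_* Φ` and
  the identification `π_* σ_* = (σ ≫ π)_* = (pr₂ ≫ π)_* = π_* pr₂_*`; on sections: `s ↦ Φ(η_σ(s)) = «ρ(s)»`
  transported along `σ⁻¹π⁻¹V = pr₂⁻¹π⁻¹V` (`pushforwardUnitSmul_app`);
* `moduleCoinvariants π E hw Φ := kernel (pushforwardUnitSnd - pushforwardUnitSmul)` — **the module of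
  invariant sections `(π_* E)^G`** (a `def` WITH BODY), its inclusion `moduleCoinvariantsι` (mono,
  injective on sections), and the SECTIONS DESCRIPTION `mem_range_moduleCoinvariantsι_app_iff`:
  `s ∈ Γ(E, π⁻¹V)` is a section of `(π_* E)^G` iff `Φ(η_σ s) = η_{pr₂} s` (on an affine chart with
  `G = Spec H` affine this reads `ρ(s) = 1 ⊗ s` — the Γ-shadow consumed by the descent adapter);
* `isAffineLocalizing_moduleCoinvariants` — quasi-coherence for `π`, `pr₂` affine and `E` quasi-coherent
  (kernel between quasi-coherent modules; ★ `Modules/QuasicoherentAbelian`, `PullbackQuasicoherent`);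
* `descentHom π E hw Φ : π^* (π_* E)^G ⟶ E` — the adjunct of the inclusion — with
  `descentHom_app_unitSection`: `η_π(x) ↦ ι(x)`.

The sequel (Dγ-geo) proves `descentHom` is an isomorphism along an fppf torsor `π` (descent of
quasi-coherent modules, [MFK94] Prop. 7.1 ∕ SGA 1 VIII 1.1; Mumford AV §12 Thm. 1 p. 112).
Everything here is proved; no named facts; the `def`s are constructions with bodies; no instance.

## References
* [MumfordAV1970] D. Mumford, *Abelian Varieties* (1970), §12 Thm. 1 (p. 111) and its proof (p. 112).
* [MumfordFogartyKirwan1994] D. Mumford, J. Fogarty, F. Kirwan, *Geometric Invariant Theory* (1994), Ch. 1 §3 Def. 1.6 (p. 30).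
* [SGA1] A. Grothendieck, SGA 1, Exp. VIII §1 (descente fidèlement plate des modules quasi-cohérents).
-/

noncomputable section

-- `TopCat.Presheaf`/`Scheme.Modules` are not reducible (as in Mathlib's `AlgebraicGeometry/Modules`).
set_option backward.isDefEq.respectTransparency false

universe u

open CategoryTheory Limits AlgebraicGeometry TopologicalSpace Opposite MonoidalCategory CartesianMonoidalCategory
open Literature.AlgebraicGeometry.Modules
open scoped MonObj

namespace Literature.AlgebraicGeometry.RelativeSpec

namespace SchemeEquivariant

variable {S : Scheme.{u}} {G X Q : Over S} [GrpObj G] [ModObj G X] (π : X ⟶ Q) (E : X.left.Modules)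

/-! ### The two maps `π_* E ⇉ π_* pr₂_* pr₂^* E` -/

omit [GrpObj G] [ModObj G X] in
/-- **`π_* η_{pr₂} : π_* E ⟶ π_* pr₂_* pr₂^* E`** («`s ↦ 1 ⊗ s`»). [cite: MumfordFogartyKirwan1994, Ch. 1 §3 Def. 1.6 (p. 30)] -/
def pushforwardUnitSnd :
    (Scheme.Modules.pushforward π.left).obj E ⟶
      (Scheme.Modules.pushforward π.left).obj ((Scheme.Modules.pushforward (snd G X).left).obj
        ((Scheme.Modules.pullback (snd G X).left).obj E)) :=
  (Scheme.Modules.pushforward π.left).map (pullbackUnit (snd G X).left E)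

set_option maxHeartbeats 400000 in
omit [GrpObj G] [ModObj G X] in
/-- Sections of `π_* η_{pr₂}`: `s ↦ η_{pr₂}(s)`. [cite: MumfordFogartyKirwan1994, Ch. 1 §3 Def. 1.6 (p. 30)] -/
theorem pushforwardUnitSnd_app (V : Q.left.Opens) (s : Γ(E, π.left ⁻¹ᵁ V)) :
    (pushforwardUnitSnd π E).app V s = unitSection (snd G X).left E (π.left ⁻¹ᵁ V) s := by
  simp only [pushforwardUnitSnd, Scheme.Modules.pushforward_map_app]
  rfl

variable (hw : γ[G, X] ≫ π = snd G X ≫ π)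
  (Φ : (Scheme.Modules.pullback (γ[G, X]).left).obj E ⟶ (Scheme.Modules.pullback (snd G X).left).obj E)

include hw in
/-- `σ ≫ π = pr₂ ≫ π` on underlying schemes. [cite: MumfordFogartyKirwan1994, Ch. 1 §3 Def. 1.6 (p. 30)] -/
theorem smul_left_comp_eq : (γ[G, X]).left ≫ π.left = (snd G X).left ≫ π.left := by
  rw [← Over.comp_left, hw, Over.comp_left]

include hw in
/-- `σ⁻¹(π⁻¹V) = pr₂⁻¹(π⁻¹V)`. [cite: MumfordFogartyKirwan1994, Ch. 1 §3 Def. 1.6 (p. 30)] -/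
theorem preimage_preimage_eq (V : Q.left.Opens) :
    (γ[G, X]).left ⁻¹ᵁ (π.left ⁻¹ᵁ V) = (snd G X).left ⁻¹ᵁ (π.left ⁻¹ᵁ V) := by
  rw [← Scheme.Hom.comp_preimage, ← Scheme.Hom.comp_preimage, smul_left_comp_eq π hw]

include hw Φ in
/-- **`π_* (η_σ ≫ σ_* Φ) : π_* E ⟶ π_* σ_* pr₂^* E = (σ ≫ π)_* pr₂^* E = (pr₂ ≫ π)_* pr₂^* E = π_* pr₂_* pr₂^* E`**
(«`s ↦ ρ(s)`»). [cite: MumfordFogartyKirwan1994, Ch. 1 §3 Def. 1.6 (p. 30)] -/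
def pushforwardUnitSmul :
    (Scheme.Modules.pushforward π.left).obj E ⟶
      (Scheme.Modules.pushforward π.left).obj ((Scheme.Modules.pushforward (snd G X).left).obj
        ((Scheme.Modules.pullback (snd G X).left).obj E)) :=
  (Scheme.Modules.pushforward π.left).map
      (pullbackUnit (γ[G, X]).left E ≫ (Scheme.Modules.pushforward (γ[G, X]).left).map Φ) ≫
    (Scheme.Modules.pushforwardComp (γ[G, X]).left π.left).hom.app _ ≫
    (Scheme.Modules.pushforwardCongr (smul_left_comp_eq π hw)).hom.app _ ≫
    (Scheme.Modules.pushforwardComp (snd G X).left π.left).inv.app _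

/-- Sections of `π_* (η_σ ≫ σ_* Φ)`: `s ↦ Φ(η_σ(s))` transported along `σ⁻¹π⁻¹V = pr₂⁻¹π⁻¹V`.
[cite: MumfordFogartyKirwan1994, Ch. 1 §3 Def. 1.6 (p. 30)] -/
theorem pushforwardUnitSmul_app (V : Q.left.Opens) (s : Γ(E, π.left ⁻¹ᵁ V)) :
    (pushforwardUnitSmul π E hw Φ).app V s =
      ((Scheme.Modules.pullback (snd G X).left).obj E).presheaf.map
        (eqToHom (preimage_preimage_eq π hw V).symm).op
        (Φ.app ((γ[G, X]).left ⁻¹ᵁ (π.left ⁻¹ᵁ V)) (unitSection (γ[G, X]).left E (π.left ⁻¹ᵁ V) s)) := by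
  simp only [pushforwardUnitSmul, Scheme.Modules.Hom.comp_app, Scheme.Modules.pushforward_map_app,
    Scheme.Modules.pushforwardComp_hom_app_app, Scheme.Modules.pushforwardCongr_hom_app_app,
    Scheme.Modules.pushforwardComp_inv_app_app, CategoryTheory.comp_apply]
  exact presheaf_map_congr _ _ _ _

/-! ### The module of invariants `(π_* E)^G` -/

include hw Φ in
/-- The difference `π_* η_{pr₂} − π_* (η_σ ≫ σ_* Φ)`, whose kernel is `(π_* E)^G`. [cite: MumfordAV1970, §12 proof of Thm. 1 (p. 112)] -/
def coinvariantsDefect :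
    (Scheme.Modules.pushforward π.left).obj E ⟶
      (Scheme.Modules.pushforward π.left).obj ((Scheme.Modules.pushforward (snd G X).left).obj
        ((Scheme.Modules.pullback (snd G X).left).obj E)) :=
  pushforwardUnitSnd π E - pushforwardUnitSmul π E hw Φ

include hw Φ in
/-- **The module of invariants `(π_* E)^G := ker (π_* E ⇉ π_* pr₂_* pr₂^* E)`** of the `G`-linearised module
`(E, Φ)` along the invariant morphism `π` (the group-scheme form of Mumford's `(π_* F)^G`).
[cite: MumfordAV1970, §12 proof of Thm. 1 (p. 112)] -/
def moduleCoinvariants : Q.left.Modules :=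
  kernel (coinvariantsDefect π E hw Φ)

/-- The inclusion `(π_* E)^G ⟶ π_* E`. [cite: MumfordAV1970, §12 proof of Thm. 1 (p. 112)] -/
def moduleCoinvariantsι : moduleCoinvariants π E hw Φ ⟶ (Scheme.Modules.pushforward π.left).obj E :=
  kernel.ι (coinvariantsDefect π E hw Φ)

/-- The inclusion of the invariants is a monomorphism. [cite: MumfordAV1970, §12 proof of Thm. 1 (p. 112)] -/
theorem mono_moduleCoinvariantsι : Mono (moduleCoinvariantsι π E hw Φ) := by
  unfold moduleCoinvariantsι; infer_instance

/-- The inclusion of the invariants is injective on sections. [cite: MumfordAV1970, §12 proof of Thm. 1 (p. 112)] -/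
theorem moduleCoinvariantsι_app_injective (V : Q.left.Opens) :
    Function.Injective ((moduleCoinvariantsι π E hw Φ).app V) :=
  kernel_ι_app_injective _ V

/-- A section is killed by the defect iff `Φ(η_σ s) = η_{pr₂} s` (after transport). [cite: MumfordAV1970, §12 proof of Thm. 1 (p. 112)] -/
theorem coinvariantsDefect_app_eq_zero_iff (V : Q.left.Opens) (s : Γ(E, π.left ⁻¹ᵁ V)) :
    (coinvariantsDefect π E hw Φ).app V s = 0 ↔
      ((Scheme.Modules.pullback (snd G X).left).obj E).presheaf.map
          (eqToHom (preimage_preimage_eq π hw V).symm).op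
          (Φ.app ((γ[G, X]).left ⁻¹ᵁ (π.left ⁻¹ᵁ V)) (unitSection (γ[G, X]).left E (π.left ⁻¹ᵁ V) s)) =
        unitSection (snd G X).left E (π.left ⁻¹ᵁ V) s := by
  have h : (coinvariantsDefect π E hw Φ).app V s =
      (pushforwardUnitSnd π E).app V s - (pushforwardUnitSmul π E hw Φ).app V s := by
    simp only [coinvariantsDefect, Scheme.Modules.Hom.sub_app]
    rfl
  rw [h, sub_eq_zero, pushforwardUnitSnd_app, pushforwardUnitSmul_app]
  exact eq_comm

/-- **Sections of the invariants**: `s ∈ Γ(E, π⁻¹V) = Γ(π_* E, V)` comes from `Γ((π_* E)^G, V)` iff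
`Φ(η_σ s) = η_{pr₂} s` in `Γ(pr₂^* E, pr₂⁻¹π⁻¹V)` (on an affine chart: `ρ(s) = 1 ⊗ s`).
[cite: MumfordAV1970, §12 proof of Thm. 1 (p. 112)] -/
theorem mem_range_moduleCoinvariantsι_app_iff (V : Q.left.Opens) (s : Γ(E, π.left ⁻¹ᵁ V)) :
    s ∈ Set.range ((moduleCoinvariantsι π E hw Φ).app V) ↔
      ((Scheme.Modules.pullback (snd G X).left).obj E).presheaf.map
          (eqToHom (preimage_preimage_eq π hw V).symm).op
          (Φ.app ((γ[G, X]).left ⁻¹ᵁ (π.left ⁻¹ᵁ V)) (unitSection (γ[G, X]).left E (π.left ⁻¹ᵁ V) s)) =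
        unitSection (snd G X).left E (π.left ⁻¹ᵁ V) s := by
  rw [← coinvariantsDefect_app_eq_zero_iff]
  constructor
  · rintro ⟨x, rfl⟩
    exact app_kernel_ι_app (coinvariantsDefect π E hw Φ) V x
  · intro h
    obtain ⟨x, hx⟩ := exists_kernel_ι_app_eq (coinvariantsDefect π E hw Φ) V s h
    exact ⟨x, hx⟩

/-- Sections of the invariants are invariant: `Φ(η_σ ι(x)) = η_{pr₂} ι(x)`. [cite: MumfordAV1970, §12 proof of Thm. 1 (p. 112)] -/
theorem moduleCoinvariantsι_app_invariant (V : Q.left.Opens) (x : Γ(moduleCoinvariants π E hw Φ, V)) :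
    ((Scheme.Modules.pullback (snd G X).left).obj E).presheaf.map
        (eqToHom (preimage_preimage_eq π hw V).symm).op
        (Φ.app ((γ[G, X]).left ⁻¹ᵁ (π.left ⁻¹ᵁ V))
          (unitSection (γ[G, X]).left E (π.left ⁻¹ᵁ V) ((moduleCoinvariantsι π E hw Φ).app V x))) =
      unitSection (snd G X).left E (π.left ⁻¹ᵁ V) ((moduleCoinvariantsι π E hw Φ).app V x) :=
  (mem_range_moduleCoinvariantsι_app_iff π E hw Φ V _).mp ⟨x, rfl⟩

/-- **The invariants of a quasi-coherent module are quasi-coherent** when `π` and `pr₂` are affine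
(kernel of a morphism between the quasi-coherent `π_* E` and `π_* pr₂_* pr₂^* E`).
[cite: MumfordAV1970, §12 proof of Thm. 1 (p. 112)] -/
theorem isAffineLocalizing_moduleCoinvariants [IsAffineHom π.left] [IsAffineHom (snd G X).left]
    (hE : IsAffineLocalizing E) : IsAffineLocalizing (moduleCoinvariants π E hw Φ) := by
  have h1 : IsAffineLocalizing ((Scheme.Modules.pushforward π.left).obj E) :=
    isAffineLocalizing_pushforward_of_isAffineHom π.left hE
  have h2 : IsAffineLocalizing ((Scheme.Modules.pushforward π.left).obj
      ((Scheme.Modules.pushforward (snd G X).left).obj ((Scheme.Modules.pullback (snd G X).left).obj E))) :=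
    isAffineLocalizing_pushforward_of_isAffineHom π.left
      (isAffineLocalizing_pushforward_of_isAffineHom (snd G X).left (hE.pullback (snd G X).left))
  exact IsAffineLocalizing.kernel _ h1 h2

/-! ### The comparison `π^* (π_* E)^G ⟶ E` -/

/-- **The comparison morphism `π^* (π_* E)^G ⟶ E`**: the adjunct of the inclusion `(π_* E)^G ⟶ π_* E`.
[cite: MumfordAV1970, §12 proof of Thm. 1 (p. 112)] -/
def descentHom : (Scheme.Modules.pullback π.left).obj (moduleCoinvariants π E hw Φ) ⟶ E :=
  ((Scheme.Modules.pullbackPushforwardAdjunction π.left).homEquiv _ E).symm (moduleCoinvariantsι π E hw Φ)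

/-- The comparison morphism on pulled-back sections: `η_π(x) ↦ ι(x)`. [cite: MumfordAV1970, §12 proof of Thm. 1 (p. 112)] -/
theorem descentHom_app_unitSection (V : Q.left.Opens) (x : Γ(moduleCoinvariants π E hw Φ, V)) :
    (descentHom π E hw Φ).app (π.left ⁻¹ᵁ V) (unitSection π.left (moduleCoinvariants π E hw Φ) V x) =
      (moduleCoinvariantsι π E hw Φ).app V x := by
  rw [descentHom, Adjunction.homEquiv_counit]
  simp only [Scheme.Modules.Hom.comp_app, CategoryTheory.comp_apply]
  rw [pullback_map_app_unitSection]
  exact counit_app_unitSection π.left E V _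

end SchemeEquivariant

end Literature.AlgebraicGeometry.RelativeSpec

end
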